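import Summits.ResolutionOfSingularities.ResolutionOfSingularities.Theorems.FrobeniusClosingPatchingRelPerfectTangentEuclidExplicit
import Summits.ResolutionOfSingularities.ResolutionOfSingularities.Theorems.FrobeniusClosingPatchingRelPerfectChartStrictTransform
import HarnessLib

/-!
# Crux `PatchingRelPerfect` (stmt-ResolutionOfSingularities-16161), chain w52 — kernel (iii)
# certificate of the cusp member, part 1a: glue lemmas and the ideal algebra of the line step

[OURS · L1 W5.2 · kernel (iii) certificate, CHAIN v1.7 §1 (C) «cusp (x₃²+x₀³)+𝔪⁴»] The hand route
of this seat's note `NONGRADED-CUSP-MEMBER.md` (evidence #52 on the crux item) for the simplest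
NON-GRADED member `I = (x₃² + x₀³) + 𝔪⁴` of the `𝔪`-primary stratum of the open core reaches, on
the `y`-charts of `Bl_𝔪`, the residual `K₃ = (c² + t a³) + (t²)` (`t` the exceptional
coordinate, `a = x₀/y`, `c = x₃/y`), of order `2` exactly along the LINE `V(t, a, c)`; blowing up
that line drops the exceptional exponent of the `t`-coefficient by one (`a`-chart:
`K_k ↦ a² · K_{k-1}`, the other two charts are Cartier), and after `k` line steps the residual
`K₀ = (t + c²) + (t²)` is the TANGENT EUCLID datum of `…TangentEuclidExplicit.lean` (p508825).
The LINE-STEP INDUCTION is proved at ring level, with the S-avatars of the note carried along as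
residual factors (so that one global companion serves every chart):

  `F_k(t, c, a) = ∏_{1 ≤ j ≤ k} (t, aʲ, c) · [ ((c² + t aᵏ) + (t²)) · ( (c², t aᵏ, t²) ·
                  ((c² + t aᵏ) + (t², t c)) ) · (t, c) ]`

This file (part 1a of 3 of the line step): elementary glue (weakly regular triples from
non-zero-divisor data and back, quasi-regularity of `![t, c, a]`, blow-ups along principal
non-zero-divisors, principal absorption) and the pure ideal algebra of the three charts of
`Bl_{(t,c,a)}` under the substitutions `t = g p, c = g q` (`a`-chart), `c = g γ, a = g α`
(`t`-chart), `t = g τ, a = g α` (`c`-chart), over an arbitrary commutative ring.  Parts 1b/1c: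
chart images and the induction `CuspMember.lineTower_isRegular`.  FORMAT evidence for the core on
the `𝔪`-primary stratum (CHAIN §1 (C)); nothing here is a statement of the manuscript under review.

## References

* Q. Liu, *Algebraic Geometry and Arithmetic Curves*, OUP 2002, Thm. 8.1.19 (a). [Liu2002]
* The Stacks Project, Tags 080A, 080B, 0804, 0BIQ. [StacksProject]
* U. Görtz, T. Wedhorn, *Algebraic Geometry I* (2nd ed., 2020), Prop. 13.96 (2). [GortzWedhorn2020]
* H. Matsumura, *Commutative Ring Theory*, CUP 1986, Thm. 16.2 (i). [Matsumura1987]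
-/

-- `Summit.<Summit>.<Sub>.Theorems` with `Sub = Summit` (single-conjunct summit, D-0017)
set_option linter.dupNamespace false

noncomputable section

open CategoryTheory CategoryTheory.Limits AlgebraicGeometry Literature.AlgebraicGeometry.Resolution
open scoped Pointwise nonZeroDivisors

namespace Summit.ResolutionOfSingularities.ResolutionOfSingularities.Theorems

universe u

namespace CuspMember

/-! ## Glue: small facts about lists, spans and non-zero-divisors -/

section Glue

variable {A : Type u} [CommRing A]

omit [CommRing A] in
/-- `List.ofFn ![t, c, a] = [t, c, a]`. [folklore] -/
theorem ofFn_vec3 (t c a : A) : List.ofFn ![t, c, a] = [t, c, a] := rfl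

omit [CommRing A] in
/-- `List.ofFn ![t, c] = [t, c]`. [folklore] -/
theorem ofFn_vec2 (t c : A) : List.ofFn ![t, c] = [t, c] := rfl

/-- `(t, c)` as a sup of principal ideals. [folklore] -/
theorem span_range_vec2 (p q : A) :
    Ideal.span (Set.range ![p, q]) = Ideal.span {p} ⊔ Ideal.span {q} := by
  rw [Matrix.range_cons, Matrix.range_cons, Matrix.range_empty, Set.union_empty,
    Set.singleton_union, Ideal.span_insert]

/-- `(t, c, a)` as a sup of principal ideals. [folklore] -/
theorem span_range_vec3 (p q r : A) :
    Ideal.span (Set.range ![p, q, r]) = Ideal.span {p} ⊔ Ideal.span {q} ⊔ Ideal.span {r} := by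
  rw [Matrix.range_cons, Matrix.range_cons, Matrix.range_cons, Matrix.range_empty, Set.union_empty,
    Set.singleton_union, Set.singleton_union, Ideal.span_insert, Ideal.span_insert, sup_assoc]

/-- `Ideal.map` of a principal ideal. [folklore] -/
theorem map_span_singleton {B : Type*} [CommRing B] (f : A →+* B) (y : A) :
    (Ideal.span {y}).map f = Ideal.span {f y} := by
  rw [Ideal.map_span, Set.image_singleton]

/-- A regular element of the ring (as a module over itself) is a non-zero-divisor. [folklore] -/
theorem mem_nonZeroDivisors_of_isSMulRegular {r : A} (h : IsSMulRegular A r) : r ∈ A⁰ :=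
  mem_nonZeroDivisors_iff_right.mpr fun x hx => h (by
    dsimp only
    rw [smul_eq_mul, smul_eq_mul, mul_comm, hx, mul_zero])

/-- If `q̄` is a non-zero-divisor of `A/I` then `q g ∈ I ⇒ g ∈ I`. [folklore] -/
theorem forall_mem_of_mk_mem_nonZeroDivisors {I : Ideal A} {q : A}
    (h : Ideal.Quotient.mk I q ∈ (A ⧸ I)⁰) (g : A) (hg : q * g ∈ I) : g ∈ I := by
  have h1 := (mem_nonZeroDivisors_iff_right.mp h) (Ideal.Quotient.mk I g)
    (by rw [← map_mul, Ideal.Quotient.eq_zero_iff_mem, mul_comm]; exact hg)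
  exact Ideal.Quotient.eq_zero_iff_mem.mp h1

/-- If `q g ∈ I ⇒ g ∈ I` then `q̄` is a non-zero-divisor of `A/I`. [folklore] -/
theorem mk_mem_nonZeroDivisors_of_forall {I : Ideal A} {q : A}
    (h : ∀ g, q * g ∈ I → g ∈ I) : Ideal.Quotient.mk I q ∈ (A ⧸ I)⁰ := by
  refine mem_nonZeroDivisors_iff_right.mpr fun z hz => ?_
  obtain ⟨g, rfl⟩ := Ideal.Quotient.mk_surjective z
  rw [← map_mul, Ideal.Quotient.eq_zero_iff_mem, mul_comm] at hz
  exact Ideal.Quotient.eq_zero_iff_mem.mpr (h g hz)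

/-- A right factor of a non-zero-divisor is a non-zero-divisor (commutative case; stated over
`CommRing` so that the instance path is the plain one). [folklore] -/
theorem mem_nonZeroDivisors_of_mul_mem {a b : A} (h : a * b ∈ A⁰) : b ∈ A⁰ :=
  mem_nonZeroDivisors_iff_right.mpr fun x hx => (mem_nonZeroDivisors_iff_right.mp h) x (by
    rw [← mul_assoc, mul_comm x a, mul_assoc, hx, mul_zero])

/-- The last member of a weakly regular sequence is regular modulo the others. [folklore] -/
theorem forall_mem_of_isWeaklyRegular_append_singleton {rs : List A} {r : A}
    (h : RingTheory.Sequence.IsWeaklyRegular A (rs ++ [r])) :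
    ∀ g, r * g ∈ Ideal.ofList rs → g ∈ Ideal.ofList rs := by
  rw [RingTheory.Sequence.isWeaklyRegular_append_iff,
    RingTheory.Sequence.isWeaklyRegular_singleton_iff, isSMulRegular_quotient_iff_mem_of_smul_mem] at h
  have e : (Ideal.ofList rs • ⊤ : Submodule A A) = Ideal.ofList rs := by rw [smul_eq_mul, Ideal.mul_top]
  intro g hg
  have := h.2 g (by rw [e, smul_eq_mul]; exact hg)
  rwa [e] at this

/-- A three-term sequence `(p, q, r)` is weakly regular if `p` is a non-zero-divisor, `q` is
regular modulo `(p)` and `r` is regular modulo `(p, q)`. [folklore] -/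
theorem isWeaklyRegular_three {p q r : A} (hp : p ∈ A⁰)
    (hq : ∀ g, q * g ∈ Ideal.span {p} → g ∈ Ideal.span {p})
    (hr : ∀ g, r * g ∈ Ideal.span {p} ⊔ Ideal.span {q} → g ∈ Ideal.span {p} ⊔ Ideal.span {q}) :
    RingTheory.Sequence.IsWeaklyRegular A [p, q, r] := by
  have e1 : (Ideal.ofList [p] • ⊤ : Submodule A A) = Ideal.span {p} := by
    rw [Ideal.ofList_singleton, smul_eq_mul, Ideal.mul_top]
  have e2 : (Ideal.ofList [p, q] • ⊤ : Submodule A A) = Ideal.span {p} ⊔ Ideal.span {q} := by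
    rw [Ideal.ofList_cons, Ideal.ofList_singleton, smul_eq_mul, Ideal.mul_top]
  have h1 : RingTheory.Sequence.IsWeaklyRegular A [p] :=
    (RingTheory.Sequence.isWeaklyRegular_singleton_iff A p).mpr
      (Module.Flat.isSMulRegular_of_nonZeroDivisors hp)
  have h2 : RingTheory.Sequence.IsWeaklyRegular A ([p] ++ [q]) := by
    refine (RingTheory.Sequence.isWeaklyRegular_append_iff A [p] [q]).mpr ⟨h1, ?_⟩
    refine (RingTheory.Sequence.isWeaklyRegular_singleton_iff _ q).mpr
      ((isSMulRegular_quotient_iff_mem_of_smul_mem _ q).mpr fun g hg => ?_)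
    rw [e1] at hg ⊢
    rw [smul_eq_mul] at hg
    exact hq g hg
  have h3 : RingTheory.Sequence.IsWeaklyRegular A ([p, q] ++ [r]) := by
    refine (RingTheory.Sequence.isWeaklyRegular_append_iff A [p, q] [r]).mpr ⟨h2, ?_⟩
    refine (RingTheory.Sequence.isWeaklyRegular_singleton_iff _ r).mpr
      ((isSMulRegular_quotient_iff_mem_of_smul_mem _ r).mpr fun g hg => ?_)
    rw [e2] at hg ⊢
    rw [smul_eq_mul] at hg
    exact hr g hg
  exact h3

/-- From `(t, c, a)` weakly regular: `t` is a non-zero-divisor. [folklore] -/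
theorem nzd_of_isWeaklyRegular₁ {t c a : A} (hw : RingTheory.Sequence.IsWeaklyRegular A [t, c, a]) :
    t ∈ A⁰ :=
  mem_nonZeroDivisors_of_isSMulRegular ((RingTheory.Sequence.isWeaklyRegular_cons_iff A t [c, a]).mp hw).1

/-- From `(t, c, a)` weakly regular: `c` is regular modulo `(t)`. [folklore] -/
theorem forall_mem_of_isWeaklyRegular₂ {t c a : A}
    (hw : RingTheory.Sequence.IsWeaklyRegular A [t, c, a]) :
    ∀ g, c * g ∈ Ideal.span {t} → g ∈ Ideal.span {t} := by
  have h2 : RingTheory.Sequence.IsWeaklyRegular A ([t] ++ [c]) :=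
    ((RingTheory.Sequence.isWeaklyRegular_append_iff A [t, c] [a]).mp hw).1
  have h := forall_mem_of_isWeaklyRegular_append_singleton h2
  rw [Ideal.ofList_singleton] at h
  exact h

/-- From `(t, c, a)` weakly regular: `a` is regular modulo `(t, c)`. [folklore] -/
theorem forall_mem_of_isWeaklyRegular₃ {t c a : A}
    (hw : RingTheory.Sequence.IsWeaklyRegular A [t, c, a]) :
    ∀ g, a * g ∈ Ideal.span {t} ⊔ Ideal.span {c} → g ∈ Ideal.span {t} ⊔ Ideal.span {c} := by
  have h3 : RingTheory.Sequence.IsWeaklyRegular A ([t, c] ++ [a]) := hw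
  have h := forall_mem_of_isWeaklyRegular_append_singleton h3
  rw [Ideal.ofList_cons, Ideal.ofList_singleton] at h
  exact h

/-- From `(t, c, a)` weakly regular: `(t, c, a)` is quasi-regular. [cite: Matsumura1987, Thm. 16.2 (i)] -/
theorem isQuasiRegular_vec3 {t c a : A} (hw : RingTheory.Sequence.IsWeaklyRegular A [t, c, a]) :
    IsQuasiRegular ![t, c, a] :=
  isQuasiRegular_of_isWeaklyRegular _ (by rw [ofFn_vec3]; exact hw)

/-- From `(t, c, a)` weakly regular: `(t, c)` is quasi-regular. [cite: Matsumura1987, Thm. 16.2 (i)] -/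
theorem isQuasiRegular_vec2 {t c a : A} (hw : RingTheory.Sequence.IsWeaklyRegular A [t, c, a]) :
    IsQuasiRegular ![t, c] :=
  isQuasiRegular_of_isWeaklyRegular _ (by
    rw [ofFn_vec2]
    exact ((RingTheory.Sequence.isWeaklyRegular_append_iff A [t, c] [a]).mp hw).1)

/-- **A blowing up along a principal ideal generated by a non-zero-divisor of a regular ring is
regular** (it is an isomorphism). [cite: StacksProject, Tag 080B (proof)] -/
theorem isRegular_of_isBlowup_span_singleton_nzd {B : Type u} [CommRing B] [hB : IsRegularRing B]
    {g : B} (hg : g ∈ B⁰) {Y : Scheme.{u}} {ρ : Y ⟶ Spec (.of B)}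
    (hρ : IsBlowup ρ (affineBlowup.idealSheaf (Ideal.span {g}))) : Scheme.IsRegular Y := by
  rw [← Ideal.mul_top (Ideal.span {g})] at hρ
  refine CoreRungTower.isRegular_of_isBlowup_span_singleton_mul hg ⊤ (fun Y' ρ' hρ' => ?_) hρ
  rw [affineBlowup.idealSheaf_top] at hρ'
  haveI : IsIso ρ' := hρ'.isIso isEffectiveCartier_top
  haveI : IsRegularRing (CommRingCat.of B) := hB
  exact SectionAscent.TraceIdeal.isRegular_of_iso (asIso ρ') (Scheme.isRegular_Spec _)

/-! ### Principal absorption -/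

/-- `(g) + (u) + (v) = (g)` if `g ∣ u`, `g ∣ v`. [folklore] -/
theorem span_sup_sup_eq {g u v : A} (hu : g ∣ u) (hv : g ∣ v) :
    Ideal.span {g} ⊔ Ideal.span {u} ⊔ Ideal.span {v} = Ideal.span {g} :=
  le_antisymm (sup_le (sup_le le_rfl (Ideal.span_singleton_le_span_singleton.mpr hu))
    (Ideal.span_singleton_le_span_singleton.mpr hv)) (le_sup_of_le_left le_sup_left)

/-- `(u) + (v) + (g) = (g)` if `g ∣ u`, `g ∣ v`. [folklore] -/
theorem sup_sup_span_eq {g u v : A} (hu : g ∣ u) (hv : g ∣ v) :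
    Ideal.span {u} ⊔ Ideal.span {v} ⊔ Ideal.span {g} = Ideal.span {g} :=
  le_antisymm (sup_le (sup_le (Ideal.span_singleton_le_span_singleton.mpr hu)
    (Ideal.span_singleton_le_span_singleton.mpr hv)) le_rfl) le_sup_right

/-- `(u) + (g) = (g)` if `g ∣ u`. [folklore] -/
theorem sup_span_eq {g u : A} (hu : g ∣ u) : Ideal.span {u} ⊔ Ideal.span {g} = Ideal.span {g} :=
  le_antisymm (sup_le (Ideal.span_singleton_le_span_singleton.mpr hu) le_rfl) le_sup_right

/-- `(g) + (u) = (g)` if `g ∣ u`. [folklore] -/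
theorem span_sup_eq {g u : A} (hu : g ∣ u) : Ideal.span {g} ⊔ Ideal.span {u} = Ideal.span {g} :=
  le_antisymm (sup_le le_rfl (Ideal.span_singleton_le_span_singleton.mpr hu)) le_sup_left

end Glue

/-! ## The ideal algebra of the three charts (any commutative ring) -/

section Algebra

variable {A : Type u} [CommRing A]

/-! ### `a`-chart: `t = g p`, `c = g q`, `a = g` -/

/-- Line avatar on the `a`-chart: `(gp, gʲ⁺², gq) = g · (p, gʲ⁺¹, q)`. [folklore] -/
theorem aChart_L (g p q : A) (j : ℕ) :
    Ideal.span {g * p} ⊔ Ideal.span {g ^ (j + 1 + 1)} ⊔ Ideal.span {g * q} =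
      Ideal.span {g} * (Ideal.span {p} ⊔ Ideal.span {g ^ (j + 1)} ⊔ Ideal.span {q}) := by
  rw [Ideal.mul_sup, Ideal.mul_sup, Ideal.span_singleton_mul_span_singleton,
    Ideal.span_singleton_mul_span_singleton, Ideal.span_singleton_mul_span_singleton, ← pow_succ']

/-- `K` on the `a`-chart: `((gq)² + gp·gᵏ⁺¹, (gp)²) = g² · ((q² + p gᵏ), p²)`. [folklore] -/
theorem aChart_K (g p q : A) (k : ℕ) :
    Ideal.span {(g * q) ^ 2 + g * p * g ^ (k + 1)} ⊔ Ideal.span {(g * p) ^ 2} =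
      Ideal.span {g ^ 2} * (Ideal.span {q ^ 2 + p * g ^ k} ⊔ Ideal.span {p ^ 2}) := by
  have e1 : (g * q) ^ 2 + g * p * g ^ (k + 1) = g ^ 2 * (q ^ 2 + p * g ^ k) := by ring
  have e2 : (g * p) ^ 2 = g ^ 2 * p ^ 2 := by ring
  rw [e1, e2, Ideal.mul_sup, Ideal.span_singleton_mul_span_singleton, Ideal.span_singleton_mul_span_singleton]

/-- `J` on the `a`-chart: `((gq)², gp·gᵏ⁺¹, (gp)²) = g² · (q², p gᵏ, p²)`. [folklore] -/
theorem aChart_J (g p q : A) (k : ℕ) :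
    Ideal.span {(g * q) ^ 2} ⊔ Ideal.span {g * p * g ^ (k + 1)} ⊔ Ideal.span {(g * p) ^ 2} =
      Ideal.span {g ^ 2} * (Ideal.span {q ^ 2} ⊔ Ideal.span {p * g ^ k} ⊔ Ideal.span {p ^ 2}) := by
  have e1 : (g * q) ^ 2 = g ^ 2 * q ^ 2 := by ring
  have e2 : g * p * g ^ (k + 1) = g ^ 2 * (p * g ^ k) := by ring
  have e3 : (g * p) ^ 2 = g ^ 2 * p ^ 2 := by ring
  rw [e1, e2, e3, Ideal.mul_sup, Ideal.mul_sup, Ideal.span_singleton_mul_span_singleton,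
    Ideal.span_singleton_mul_span_singleton, Ideal.span_singleton_mul_span_singleton]

/-- `A = K + (tc)` on the `a`-chart: `g² K′ + (gp·gq) = g² · (K′ + (pq))`. [folklore] -/
theorem aChart_A (g p q : A) (K' : Ideal A) :
    Ideal.span {g ^ 2} * K' ⊔ Ideal.span {g * p * (g * q)} =
      Ideal.span {g ^ 2} * (K' ⊔ Ideal.span {p * q}) := by
  have e1 : g * p * (g * q) = g ^ 2 * (p * q) := by ring
  rw [e1, Ideal.mul_sup, Ideal.span_singleton_mul_span_singleton]

/-- `(t, c)` on the `a`-chart: `(gp, gq) = g · (p, q)`. [folklore] -/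
theorem aChart_S (g p q : A) :
    Ideal.span {g * p} ⊔ Ideal.span {g * q} = Ideal.span {g} * (Ideal.span {p} ⊔ Ideal.span {q}) := by
  rw [Ideal.mul_sup, Ideal.span_singleton_mul_span_singleton, Ideal.span_singleton_mul_span_singleton]

/-! ### `t`-chart: `t = g`, `c = g γ`, `a = g α` — everything is a power of `g` -/

/-- Line avatar on the `t`-chart. [folklore] -/
theorem tChart_L (g γ α : A) (j : ℕ) :
    Ideal.span {g} ⊔ Ideal.span {(g * α) ^ (j + 1 + 1)} ⊔ Ideal.span {g * γ} = Ideal.span {g} :=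
  span_sup_sup_eq ⟨g ^ (j + 1) * α ^ (j + 1 + 1), by ring⟩ ⟨γ, rfl⟩

/-- `K` on the `t`-chart. [folklore] -/
theorem tChart_K (g γ α : A) (k : ℕ) :
    Ideal.span {(g * γ) ^ 2 + g * (g * α) ^ (k + 1)} ⊔ Ideal.span {g ^ 2} = Ideal.span {g ^ 2} :=
  sup_span_eq ⟨γ ^ 2 + g ^ k * α ^ (k + 1), by ring⟩

/-- `J` on the `t`-chart. [folklore] -/
theorem tChart_J (g γ α : A) (k : ℕ) :
    Ideal.span {(g * γ) ^ 2} ⊔ Ideal.span {g * (g * α) ^ (k + 1)} ⊔ Ideal.span {g ^ 2} =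
      Ideal.span {g ^ 2} :=
  sup_sup_span_eq ⟨γ ^ 2, by ring⟩ ⟨g ^ k * α ^ (k + 1), by ring⟩

/-- `A` on the `t`-chart. [folklore] -/
theorem tChart_A (g γ : A) :
    Ideal.span {g ^ 2} ⊔ Ideal.span {g * (g * γ)} = Ideal.span {g ^ 2} :=
  span_sup_eq ⟨γ, by ring⟩

/-- `(t, c)` on the `t`-chart. [folklore] -/
theorem tChart_S (g γ : A) : Ideal.span {g} ⊔ Ideal.span {g * γ} = Ideal.span {g} :=
  span_sup_eq ⟨γ, rfl⟩

/-! ### `c`-chart: `t = g τ`, `c = g`, `a = g α` — everything is a power of `g` -/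

/-- Line avatar on the `c`-chart. [folklore] -/
theorem cChart_L (g τ α : A) (j : ℕ) :
    Ideal.span {g * τ} ⊔ Ideal.span {(g * α) ^ (j + 1 + 1)} ⊔ Ideal.span {g} = Ideal.span {g} :=
  sup_sup_span_eq ⟨τ, rfl⟩ ⟨g ^ (j + 1) * α ^ (j + 1 + 1), by ring⟩

/-- `K` on the `c`-chart: `(g² + gτ (gα)ᵏ⁺¹, (gτ)²) = g² · ((1 + τ gᵏ αᵏ⁺¹), τ²) = (g²)` — the
unit `1` is nilpotent modulo the residual. [folklore] -/
theorem cChart_K (g τ α : A) (k : ℕ) :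
    Ideal.span {g ^ 2 + g * τ * (g * α) ^ (k + 1)} ⊔ Ideal.span {(g * τ) ^ 2} = Ideal.span {g ^ 2} := by
  have e1 : Ideal.span {g ^ 2 + g * τ * (g * α) ^ (k + 1)} ⊔ Ideal.span {(g * τ) ^ 2} =
      Ideal.span {g ^ 2} * (Ideal.span {1 + τ * (g ^ k * α ^ (k + 1))} ⊔ Ideal.span {τ ^ 2}) := by
    have f1 : g ^ 2 + g * τ * (g * α) ^ (k + 1) = g ^ 2 * (1 + τ * (g ^ k * α ^ (k + 1))) := by ring
    have f2 : (g * τ) ^ 2 = g ^ 2 * τ ^ 2 := by ring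
    rw [f1, f2, Ideal.mul_sup, Ideal.span_singleton_mul_span_singleton, Ideal.span_singleton_mul_span_singleton]
  have e2 : Ideal.span {1 + τ * (g ^ k * α ^ (k + 1))} ⊔ Ideal.span {τ ^ 2} = (⊤ : Ideal A) := by
    refine CoreRungTower.eq_top_of_isUnit_eq_sub isUnit_one (h := 1 + τ * (g ^ k * α ^ (k + 1)))
      (n := τ * (g ^ k * α ^ (k + 1))) (by ring) _ 1 2 ?_ ?_
    · rw [pow_one]; exact Ideal.mem_sup_left (Ideal.mem_span_singleton_self _)
    · exact Ideal.mem_sup_right (Ideal.mem_span_singleton.mpr ⟨(g ^ k * α ^ (k + 1)) ^ 2, by ring⟩)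
  rw [e1, e2, Ideal.mul_top]

/-- `J` on the `c`-chart. [folklore] -/
theorem cChart_J (g τ α : A) (k : ℕ) :
    Ideal.span {g ^ 2} ⊔ Ideal.span {g * τ * (g * α) ^ (k + 1)} ⊔ Ideal.span {(g * τ) ^ 2} =
      Ideal.span {g ^ 2} :=
  span_sup_sup_eq ⟨τ * (g ^ k * α ^ (k + 1)), by ring⟩ ⟨τ ^ 2, by ring⟩

/-- `A` on the `c`-chart. [folklore] -/
theorem cChart_A (g τ : A) :
    Ideal.span {g ^ 2} ⊔ Ideal.span {g * τ * g} = Ideal.span {g ^ 2} :=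
  span_sup_eq ⟨τ, by ring⟩

/-- `(t, c)` on the `c`-chart. [folklore] -/
theorem cChart_S (g τ : A) : Ideal.span {g * τ} ⊔ Ideal.span {g} = Ideal.span {g} :=
  sup_span_eq ⟨τ, rfl⟩

end Algebra

end CuspMember

end Summit.ResolutionOfSingularities.ResolutionOfSingularities.Theorems

end
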